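import Summits.CriticalPhenomena.SAWScalingLimit.Theorems.SAWTotalPositivityBoundaryTP2Defs
import Summits.CriticalPhenomena.SAWScalingLimit.Theorems.SAWTotalPositivityBoundaryTP2Kernel
import Summits.CriticalPhenomena.SAWScalingLimit.Theorems.SAWTotalPositivityBoundaryTP2Symmetry
import Summits.CriticalPhenomena.SAWScalingLimit.Theorems.SAWTotalPositivityBoundaryTP2FirstStep
import Summits.CriticalPhenomena.SAWScalingLimit.Theorems.SAWTotalPositivityBoundaryTP2Avoid
import Summits.CriticalPhenomena.SAWScalingLimit.Theorems.SAWTotalPositivityBoundaryTP2SquareGadget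
import Summits.CriticalPhenomena.SAWScalingLimit.Theorems.EdgeOfPositivity.Negative.EdgeOfPositivityRectDomain
import HarnessLib

/-!
# Crux `BoundaryTP2` (stmt-CriticalPhenomena-7115), line `Sketch`: strip-3 transfer, middle of the last column

Tool stub `stub_strip3_recMid` of the line's skeleton (c6 three-row strip programme). On the strip
`S_L = discreteDomainGraph (rectDomain L 2) 1` (sites `{0..L} × {0,1,2}`, lattice adjacency) write
`Z_L(r→s) = Z_{S_L}((0,r),(L,s))` for the fugacity-`x` self-avoiding path kernel from the left column.
The kernel of `S_{L+1}` into the MIDDLE site `m = (L+1,1)` of the new column satisfies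

  `Z_{L+1}(r→1) = x Z_L(r→1) + x² (Z_L(r→0) + Z_L(r→2))`     (`x ≥ 0`, `0 ≤ r ≤ 2`, all `L : ℕ`).

Proof. Reverse the paths so that they start at `m`, whose neighbours in `S_{L+1}` are `(L,1)` and
the two new corners `c₀ = (L+1,0)`, `c₂ = (L+1,2)` (first step at a vertex of degree three). In
`S_{L+1} - m` both corners are leaves, hanging on `(L,0)` and `(L,2)`:
* the paths from `(L,1)` to `(0,r)` visit neither leaf (`pathKernel_eq_deleteVert_of_leaf`, twice);
* the paths from `c_s` start with the edge to `(L,s)` (`pathKernel_firstStep_single`) and then never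
  visit the other leaf;
and `((S_{L+1} - m) - c_s) - c_{2-s} = S_L` as simple graphs on `Site 2` (coordinates and `omega`).
-/

noncomputable section

namespace Summit.CriticalPhenomena.SAWScalingLimit.Theorems.BoundaryTP2

open Literature.Probability.LatticeModels Literature.Probability.RandomPlanarGeometry
open Summit.CriticalPhenomena.SAWScalingLimit.Theorems.EdgeOfPositivity.Negative
open scoped ENNReal

/-! ## First step at a vertex of degree three -/

/-- **First step at a vertex with exactly three neighbours.** If `N_H(a) = {v₁, v₂, v₃}` (pairwise
distinct) and `a ≠ b`, then `Z_H(a,b) = x · (Z_{H-a}(v₁,b) + Z_{H-a}(v₂,b) + Z_{H-a}(v₃,b))` (`0 ≤ x`).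
[folklore] -/
private theorem s3mid_firstStep_triple {V : Type*} [DecidableEq V] (H : SimpleGraph V) (x : ℝ)
    (hx : 0 ≤ x) {a b v₁ v₂ v₃ : V} (hab : a ≠ b) (h₁₂ : v₁ ≠ v₂) (h₁₃ : v₁ ≠ v₃) (h₂₃ : v₂ ≠ v₃)
    (hN : H.neighborSet a = {v₁, v₂, v₃}) :
    pathKernel H x a b = ENNReal.ofReal x *
      (pathKernel (H.deleteEdges (H.incidenceSet a)) x v₁ b +
        (pathKernel (H.deleteEdges (H.incidenceSet a)) x v₂ b +
          pathKernel (H.deleteEdges (H.incidenceSet a)) x v₃ b)) := by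
  -- adapted from `ladderInt_firstStep_triple` (…BoundaryTP2LadderKernelsInterior)
  have h₁ : H.Adj a v₁ := by rw [← SimpleGraph.mem_neighborSet, hN]; exact Set.mem_insert _ _
  have h₂ : H.Adj a v₂ := by
    rw [← SimpleGraph.mem_neighborSet, hN]; exact Set.mem_insert_of_mem _ (Set.mem_insert _ _)
  have h₃ : H.Adj a v₃ := by
    rw [← SimpleGraph.mem_neighborSet, hN]
    exact Set.mem_insert_of_mem _ (Set.mem_insert_of_mem _ (Set.mem_singleton _))
  rw [stub_pathKernel_firstStep H x hx a b hab]
  congr 1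
  set f : V → ℝ≥0∞ := fun u => pathKernelOn H x u b {γ | a ∉ γ.1.support} with hf
  have hcoe : H.neighborSet a = ((({v₁, v₂, v₃} : Finset V) : Set V)) := by
    rw [hN, Finset.coe_insert, Finset.coe_pair]
  calc ∑' u : H.neighborSet a, pathKernelOn H x u b {γ | a ∉ γ.1.support}
      = ∑' u : H.neighborSet a, f u := rfl
    _ = ∑' u : ((({v₁, v₂, v₃} : Finset V) : Set V)), f u := tsum_congr_set_coe f hcoe
    _ = ∑ u ∈ ({v₁, v₂, v₃} : Finset V), f u := Finset.tsum_subtype' _ f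
    _ = f v₁ + (f v₂ + f v₃) := by
        rw [Finset.sum_insert (by simp [h₁₂, h₁₃]), Finset.sum_pair h₂₃]
    _ = _ := by
        simp only [hf]
        rw [stub_pathKernelOn_avoid H x v₁ b a h₁.ne.symm hab.symm,
          stub_pathKernelOn_avoid H x v₂ b a h₂.ne.symm hab.symm,
          stub_pathKernelOn_avoid H x v₃ b a h₃.ne.symm hab.symm]

/-! ## Coordinates on the three-row strip -/

/-- Adjacency in `ℤ²` in coordinates: the sites agree in one coordinate and differ by `1` in the
other. [folklore] -/
private theorem s3mid_zd_adj_iff (u v : Site 2) :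
    (zdGraph 2).Adj u v ↔
      ((v 0 = u 0 + 1 ∨ u 0 = v 0 + 1) ∧ v 1 = u 1) ∨
        ((v 1 = u 1 + 1 ∨ u 1 = v 1 + 1) ∧ v 0 = u 0) := by
  -- adapted from `ladder_zd_adj_iff` (…BoundaryTP2LadderKernels)
  rw [zdGraph_adj_iff, Fin.exists_fin_two]
  simp only [funext_iff, Fin.forall_fin_two, Pi.add_apply, Pi.single_eq_same,
    Pi.single_eq_of_ne (one_ne_zero : (1 : Fin 2) ≠ 0),
    Pi.single_eq_of_ne (zero_ne_one : (0 : Fin 2) ≠ 1), add_zero]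
  omega

/-- A site equals `st a b` iff its two coordinates are `a` and `b`. [folklore] -/
private theorem s3mid_eq_st_iff (v : Site 2) (a b : ℤ) : v = st a b ↔ v 0 = a ∧ v 1 = b := by
  constructor
  · rintro rfl
    exact ⟨rfl, rfl⟩
  · rintro ⟨h0, h1⟩
    rw [← st_eta v, h0, h1]

/-- Adjacency of the three-row strip `{0..a} × {0,1,2}` in coordinates. [folklore] -/
private theorem s3mid_adj_iff (a : ℕ) (u v : Site 2) :
    (discreteDomainGraph (rectDomain a 2) 1).Adj u v ↔
      (((v 0 = u 0 + 1 ∨ u 0 = v 0 + 1) ∧ v 1 = u 1) ∨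
          ((v 1 = u 1 + 1 ∨ u 1 = v 1 + 1) ∧ v 0 = u 0)) ∧
        ((0 ≤ u 0 ∧ u 0 ≤ a) ∧ (0 ≤ u 1 ∧ u 1 ≤ 2)) ∧
          ((0 ≤ v 0 ∧ v 0 ≤ a) ∧ (0 ≤ v 1 ∧ v 1 ≤ 2)) := by
  rw [adj_rect_iff, s3mid_zd_adj_iff, mem_rectSites_iff, mem_rectSites_iff, Nat.cast_ofNat]

/-! ## The last column of `S_{L+1}` seen from its middle site -/

/-- In `S_{L+1}` the middle site `m = (L+1,1)` of the last column has exactly the three neighbours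
`(L,1)`, `(L+1,0)`, `(L+1,2)`. [folklore] -/
private theorem s3mid_mid_neighborSet (L : ℕ) :
    (discreteDomainGraph (rectDomain (L + 1) 2) 1).neighborSet (st (L + 1 : ℕ) 1) =
      {st L 1, st (L + 1 : ℕ) 0, st (L + 1 : ℕ) 2} := by
  ext v
  rw [SimpleGraph.mem_neighborSet, s3mid_adj_iff, Set.mem_insert_iff, Set.mem_insert_iff,
    Set.mem_singleton_iff, s3mid_eq_st_iff, s3mid_eq_st_iff, s3mid_eq_st_iff, st_zero, st_one]
  omega

/-- In `S_{L+1} - m` (`m = (L+1,1)`) the corner `(L+1,s)`, `s ∈ {0,2}`, is a leaf: its only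
neighbour is `(L,s)`. [folklore] -/
private theorem s3mid_corner_neighborSet (L : ℕ) (s : ℤ) (hs : s = 0 ∨ s = 2) :
    ((discreteDomainGraph (rectDomain (L + 1) 2) 1).deleteEdges
        ((discreteDomainGraph (rectDomain (L + 1) 2) 1).incidenceSet (st (L + 1 : ℕ) 1))).neighborSet
        (st (L + 1 : ℕ) s) = {st L s} := by
  ext v
  rw [SimpleGraph.mem_neighborSet, deleteEdges_incidenceSet_adj, s3mid_adj_iff,
    Set.mem_singleton_iff, Ne, Ne, s3mid_eq_st_iff, s3mid_eq_st_iff, s3mid_eq_st_iff]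
  simp only [st_zero, st_one]
  push_cast
  omega

/-- In `(S_{L+1} - m) - c_s` (`m = (L+1,1)`, `c_s = (L+1,s)`, `{s,t} = {0,2}`) the opposite corner
`c_t = (L+1,t)` is a leaf: its only neighbour is `(L,t)`. [folklore] -/
private theorem s3mid_hanging_neighborSet (L : ℕ) (s t : ℤ) (hst : s = 0 ∧ t = 2 ∨ s = 2 ∧ t = 0) :
    (((discreteDomainGraph (rectDomain (L + 1) 2) 1).deleteEdges
        ((discreteDomainGraph (rectDomain (L + 1) 2) 1).incidenceSet (st (L + 1 : ℕ) 1))).deleteEdges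
      (((discreteDomainGraph (rectDomain (L + 1) 2) 1).deleteEdges
        ((discreteDomainGraph (rectDomain (L + 1) 2) 1).incidenceSet (st (L + 1 : ℕ) 1))).incidenceSet
          (st (L + 1 : ℕ) s))).neighborSet (st (L + 1 : ℕ) t) = {st L t} := by
  ext v
  rw [SimpleGraph.mem_neighborSet, deleteEdges_incidenceSet_adj, deleteEdges_incidenceSet_adj,
    s3mid_adj_iff, Set.mem_singleton_iff, Ne, Ne, Ne, Ne, s3mid_eq_st_iff, s3mid_eq_st_iff,
    s3mid_eq_st_iff, s3mid_eq_st_iff, s3mid_eq_st_iff]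
  simp only [st_zero, st_one]
  push_cast
  omega

/-- Deleting the whole last column of `S_{L+1}` leaves `S_L`:
`((S_{L+1} - m) - c_s) - c_t = S_L` as simple graphs on `Site 2` (`m = (L+1,1)`, `c_s = (L+1,s)`,
`c_t = (L+1,t)`, `{s,t} = {0,2}`). [folklore] -/
private theorem s3mid_delete_lastColumn (L : ℕ) (s t : ℤ) (hst : s = 0 ∧ t = 2 ∨ s = 2 ∧ t = 0) :
    ((((discreteDomainGraph (rectDomain (L + 1) 2) 1).deleteEdges
        ((discreteDomainGraph (rectDomain (L + 1) 2) 1).incidenceSet (st (L + 1 : ℕ) 1))).deleteEdges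
      (((discreteDomainGraph (rectDomain (L + 1) 2) 1).deleteEdges
        ((discreteDomainGraph (rectDomain (L + 1) 2) 1).incidenceSet (st (L + 1 : ℕ) 1))).incidenceSet
          (st (L + 1 : ℕ) s))).deleteEdges
      ((((discreteDomainGraph (rectDomain (L + 1) 2) 1).deleteEdges
        ((discreteDomainGraph (rectDomain (L + 1) 2) 1).incidenceSet (st (L + 1 : ℕ) 1))).deleteEdges
      (((discreteDomainGraph (rectDomain (L + 1) 2) 1).deleteEdges
        ((discreteDomainGraph (rectDomain (L + 1) 2) 1).incidenceSet (st (L + 1 : ℕ) 1))).incidenceSet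
          (st (L + 1 : ℕ) s))).incidenceSet (st (L + 1 : ℕ) t))) =
      discreteDomainGraph (rectDomain L 2) 1 := by
  -- adapted from `ladder_delete_lastColumn` (…BoundaryTP2LadderKernels)
  ext u v
  rw [deleteEdges_incidenceSet_adj, deleteEdges_incidenceSet_adj, deleteEdges_incidenceSet_adj,
    adj_rect_iff, adj_rect_iff]
  constructor
  · rintro ⟨⟨⟨⟨hzd, hu, hv⟩, hum, hvm⟩, hus, hvs⟩, hut, hvt⟩
    rw [mem_rectSites_iff] at hu hv
    rw [Ne, s3mid_eq_st_iff] at hum hvm hus hvs hut hvt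
    refine ⟨hzd, ?_, ?_⟩
    · clear hvm hvs hvt
      rw [mem_rectSites_iff]; omega
    · clear hum hus hut
      rw [mem_rectSites_iff]; omega
  · rintro ⟨hzd, hu, hv⟩
    rw [mem_rectSites_iff] at hu hv
    refine ⟨⟨⟨⟨hzd, ?_, ?_⟩, ?_, ?_⟩, ?_, ?_⟩, ?_, ?_⟩
    · rw [mem_rectSites_iff]; omega
    · rw [mem_rectSites_iff]; omega
    all_goals rw [Ne, s3mid_eq_st_iff]; omega

/-! ## The recursion -/

/-- STUB C1 (`stub_strip3_recMid`). Last-column recursion for the kernel to the MIDDLE of the new column: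
the last step into `(L+1,1)` comes from `(L,1)` (then the two other new sites are leaves, never visited)
or from a new corner `(L+1,s')`, entered from `(L,s')` (then the third new site is a leaf). [folklore] -/
theorem stub_strip3_recMid (L : ℕ) {x : ℝ} (hx : 0 ≤ x) (r : ℤ) (hr : 0 ≤ r ∧ r ≤ 2) :
    pathKernel (discreteDomainGraph (rectDomain (L + 1) 2) 1) x (st 0 r) (st (L + 1 : ℕ) 1) =
      ENNReal.ofReal x * pathKernel (discreteDomainGraph (rectDomain L 2) 1) x (st 0 r) (st L 1) +
        ENNReal.ofReal (x ^ 2) *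
          (pathKernel (discreteDomainGraph (rectDomain L 2) 1) x (st 0 r) (st L 0) +
            pathKernel (discreteDomainGraph (rectDomain L 2) 1) x (st 0 r) (st L 2)) := by
  classical
  obtain ⟨-, -⟩ := hr -- the row constraint on the start is not needed
  set S := discreteDomainGraph (rectDomain (L + 1) 2) 1
  -- distinctness of the sites involved (columns `0`, `L`, `L + 1`; rows `0, 1, 2`)
  have hma : st (L + 1 : ℕ) 1 ≠ st 0 r := by
    rw [Ne, s3mid_eq_st_iff, st_zero]; push_cast; omega
  have hc0a : st (L + 1 : ℕ) 0 ≠ st 0 r := by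
    rw [Ne, s3mid_eq_st_iff, st_zero]; push_cast; omega
  have hc2a : st (L + 1 : ℕ) 2 ≠ st 0 r := by
    rw [Ne, s3mid_eq_st_iff, st_zero]; push_cast; omega
  have h12 : st (L : ℤ) 1 ≠ st (L + 1 : ℕ) 0 := by
    rw [Ne, s3mid_eq_st_iff, st_zero]; push_cast; omega
  have h13 : st (L : ℤ) 1 ≠ st (L + 1 : ℕ) 2 := by
    rw [Ne, s3mid_eq_st_iff, st_zero]; push_cast; omega
  have h23 : st (L + 1 : ℕ) 0 ≠ st (L + 1 : ℕ) 2 := by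
    rw [Ne, s3mid_eq_st_iff, st_zero, st_one]; omega
  have hv0c2 : st (L : ℤ) 0 ≠ st (L + 1 : ℕ) 2 := by
    rw [Ne, s3mid_eq_st_iff, st_zero]; push_cast; omega
  have hv2c0 : st (L : ℤ) 2 ≠ st (L + 1 : ℕ) 0 := by
    rw [Ne, s3mid_eq_st_iff, st_zero]; push_cast; omega
  -- first step at the middle site `m = (L+1, 1)`
  have hN : S.neighborSet (st (L + 1 : ℕ) 1) = {st L 1, st (L + 1 : ℕ) 0, st (L + 1 : ℕ) 2} :=
    s3mid_mid_neighborSet L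
  rw [pathKernel_comm S x (st 0 r) (st (L + 1 : ℕ) 1),
    s3mid_firstStep_triple S x hx hma h12 h13 h23 hN]
  set S' := S.deleteEdges (S.incidenceSet (st (L + 1 : ℕ) 1))
  -- the two corners are leaves of `S'`
  have hN0 : S'.neighborSet (st (L + 1 : ℕ) 0) = {st L 0} := s3mid_corner_neighborSet L 0 (Or.inl rfl)
  have hN2 : S'.neighborSet (st (L + 1 : ℕ) 2) = {st L 2} := s3mid_corner_neighborSet L 2 (Or.inr rfl)
  have hleaf0 : ∀ z, S'.Adj (st (L + 1 : ℕ) 0) z → z = st L 0 := fun z hz => by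
    have hz' : z ∈ S'.neighborSet (st (L + 1 : ℕ) 0) := hz
    rwa [hN0, Set.mem_singleton_iff] at hz'
  set T₀ := S'.deleteEdges (S'.incidenceSet (st (L + 1 : ℕ) 0))
  set T₂ := S'.deleteEdges (S'.incidenceSet (st (L + 1 : ℕ) 2))
  have hT0N : T₀.neighborSet (st (L + 1 : ℕ) 2) = {st L 2} :=
    s3mid_hanging_neighborSet L 0 2 (Or.inl ⟨rfl, rfl⟩)
  have hT2N : T₂.neighborSet (st (L + 1 : ℕ) 0) = {st L 0} :=
    s3mid_hanging_neighborSet L 2 0 (Or.inr ⟨rfl, rfl⟩)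
  have hT0leaf : ∀ z, T₀.Adj (st (L + 1 : ℕ) 2) z → z = st L 2 := fun z hz => by
    have hz' : z ∈ T₀.neighborSet (st (L + 1 : ℕ) 2) := hz
    rwa [hT0N, Set.mem_singleton_iff] at hz'
  have hT2leaf : ∀ z, T₂.Adj (st (L + 1 : ℕ) 0) z → z = st L 0 := fun z hz => by
    have hz' : z ∈ T₂.neighborSet (st (L + 1 : ℕ) 0) := hz
    rwa [hT2N, Set.mem_singleton_iff] at hz'
  have hT0L : T₀.deleteEdges (T₀.incidenceSet (st (L + 1 : ℕ) 2)) =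
      discreteDomainGraph (rectDomain L 2) 1 :=
    s3mid_delete_lastColumn L 0 2 (Or.inl ⟨rfl, rfl⟩)
  have hT2L : T₂.deleteEdges (T₂.incidenceSet (st (L + 1 : ℕ) 0)) =
      discreteDomainGraph (rectDomain L 2) 1 :=
    s3mid_delete_lastColumn L 2 0 (Or.inr ⟨rfl, rfl⟩)
  -- term `(L,1)`: the paths to `(0,r)` visit neither corner
  rw [pathKernel_eq_deleteVert_of_leaf S' x hleaf0 h12 hc0a.symm,
    pathKernel_eq_deleteVert_of_leaf T₀ x hT0leaf h13 hc2a.symm, hT0L]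
  -- term `c₀ = (L+1,0)`: first step to `(L,0)`, then `c₂` is never visited
  rw [pathKernel_firstStep_single S' x hx hc0a hN0,
    pathKernel_eq_deleteVert_of_leaf T₀ x hT0leaf hv0c2 hc2a.symm, hT0L]
  -- term `c₂ = (L+1,2)`: first step to `(L,2)`, then `c₀` is never visited
  rw [pathKernel_firstStep_single S' x hx hc2a hN2,
    pathKernel_eq_deleteVert_of_leaf T₂ x hT2leaf hv2c0 hc0a.symm, hT2L]
  -- back to paths from `(0,r)` and bookkeeping in `ℝ≥0∞`
  rw [pathKernel_comm _ x (st (L : ℤ) 1) (st 0 r), pathKernel_comm _ x (st (L : ℤ) 0) (st 0 r),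
    pathKernel_comm _ x (st (L : ℤ) 2) (st 0 r), pow_two, ENNReal.ofReal_mul hx]
  ring

end Summit.CriticalPhenomena.SAWScalingLimit.Theorems.BoundaryTP2
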